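import Summits.QuantumFields.YangMills.Theorems.BalabanUVNodesN16PrintLetters
import Summits.QuantumFields.YangMills.Theorems.BalabanUVNodesN16Thm4OutputLandau138
import HarnessLib

/-!
# Route «BalabanUVNodes» (K4 «SpineRates»), DAG node N16 = NE3 — THE GEOMETRY-NEUTRAL N05 → N16 EDGE IN PRINT's LETTERS ONLY: the `d = 4` record knit and the
# DECL column over the binder (OUT_print) = [B8] Theorem 4's OUTPUT at the minimiser pair with EVERY member in print's ∕ node N05's letters ((1.29) `Restr129`,
# «U₁ = U′^{u⁻¹} = e^{iηA}» via `mgauge`∕`cfgExp`, (1.36)₁₂ sup ∕ `covDerivFwd`, (1.36)₃ nearest-neighbour Hölder of `covDerivFwd` along `μ`, (1.38) `IsLandau138`,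
# (1.39)₁ `covLap`)

Cell `pub-ymgap`, seat `pub-ymgap-dag-n16-a` (KNIT-BY-NAME, D-0062; chair R424 venue), generation 4, file 12; `--supports stmt-QuantumFields-19182`; `bears_on:
R4∕N16 · edge N05 → N16`.  File 11 (`…N16PrintLetters`, p428632) proved (OUT_print) ⟹ (OUT₁₃₈) at adjustable output letters; file 9 (`…N16Thm4OutputLandau138`,
p424658) knitted the record and the DECL column from (OUT₁₃₈).  HERE the two are composed: the N05-side hypothesis of N16 becomes Theorem 4's OUTPUT in print's
letters and nothing else, on FOUR k-free letter lines relating Theorem 4's sizes `(s, g′, hol, ℓ)` to THE END's letters `(s₁, s₂)`: `s ≤ s₁`, `g′ + 2α_{b′}s₁ ≤ s₁`,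
`ℓ + 16α_{b′}s ≤ s₁`, `hol + 8α_{b′}s ≤ s₂` (`α_{b′} = b′ + 226·320²·b′²` the (H3ˢᵘᵖ) radius).  Companion file 13 (`…N16Thm4Print`) replaces (OUT_print) by print's
Theorem 4 ITSELF in the all-torus geometry with its conclusion slot written out (no dictionary binder).
§1 `n16_of_thm4OutputPrint` (`d = 4`): file 9 §3 ∘ file 11 §3.  §2 `ne3Shape_of_thm4OutputPrint` (`d = 4`): file 9 §4 ∘ file 11 §3 (g2's numeric regime).
HONEST FRAMING: bookkeeping by name, 0 def; (OUT_print) = [Balaban1985RegularSpaces] Thm 4 ∕ Thm 2 + Prop 3 OUTPUT TYPE at curved backgrounds, torus geometry — node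
N05's theorem, NOT proved in the tree; (H3ˢᵘᵖ) = N07's [Balaban1985Variational] Thm 1 TYPE; Hölder exponent `β = 1` = [Balaban1985Variational] (9) (census caveat
(c2)); N16 ∕ NE3 NOT discharged; count-neutral; finite T⁴ at fixed ε — NOT ℝ⁴, NOT infinite volume, NOT OS, NOT a mass gap, NOT Clay.
-/

set_option autoImplicit false

open scoped BigOperators Matrix Matrix.Norms.L2Operator
open NormedSpace

namespace Summit.QuantumFields.YangMills.BalabanUVNodes.N16

open Literature.MathematicalPhysics.QuantumFieldTheory.Balaban1983to89
open B7Prop1Explicit B7Prop2Explicit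
open T4AveragingDeficitWall (IsUnitaryCfg Ad fineAction blockSites)
open T4AveragingDeficitWallBoundary (periodBox)
open T4EtaRateMin (NE3Shape)
open B8Lemma1NonAbelian (pert)
open B7Eq92Concrete (mgauge)
open B8Ineq132 (covDerivFwd)
open B8Eq184Proof (cfgExp)
open B8Eq119TwistedAxial (Restr129)
open B8Eq166ConstraintPair (ptw)
open B8Eq138LandauZd (covLap IsLandau138)
open B8Thm4TorusAt (torusLam)
open Summit.QuantumFields.BalabanUV.T4Continuum
open MinimalActionSandwich (IsMinimiser)
open MinimalActionRate (Regular sfClass minActReadings)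
open MinimalActionRefine (RegularSup gradConst)
open BlockAverageCurrent (curConst curConst_nonneg)
open NE3EnergyShapes (IsPeriodicSite)
open NE3EnergyWeightedCovShape (NE3EnergyRateWCov)
open NE3RightInverseSupLetters (frameC)
open NE3.LeafIndexSockets (LeafH3sup)

noncomputable section

variable {n : Type*} [Fintype n] [DecidableEq n]

/-! ## §1 The `d = 4` record knit over (OUT_print) -/

/-- **N16 · NE3 BY NAME FROM [B8] THM 4's OUTPUT AT THE PAIR IN PRINT's LETTERS AND N07's INTERFACE** (`d = 4`; `L ≥ 2`, `N ≥ 1`): `∃ r > 0, ∀ g > 0, ∃ C ≥ 0,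
∀ b′ c′` on file 7's three ε-free leaf lines, `∀ 0 < ε ≤ r, 0 ≤ s₁ ≤ r, 0 ≤ b ≤ ε∕2`, `∀ s g′ hol ℓ s₂` on FOUR k-free letter lines (`s ≤ s₁`, `g′ + 2α_{b′}s₁ ≤ s₁`,
`ℓ + 16α_{b′}s ≤ s₁`, `hol + 8α_{b′}s ≤ s₂`; `α_{b′} = b′ + 226·320²·b′²`), `∀ dom`: (OUT_print) at `(s, g′, hol, ℓ, β = 1)` → `LeafH3sup 4 L N ε b′ c′ dom` →
`NE3EnergyRateWCov 4 (sfClass 4 L N ε) L N b g C s₁ s₂ dom` (= `YMDAG.N16 …`).  File 9 §3 ∘ file 11 §3.  N16 ∕ NE3 NOT proved. [folklore] -/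
theorem n16_of_thm4OutputPrint [Nonempty n] {L N : ℕ} (hL : 2 ≤ L) (hN : 1 ≤ N) :
    ∃ r : ℝ, 0 < r ∧ ∀ ⦃g : ℝ⦄, 0 < g → ∃ C : ℝ, 0 ≤ C ∧ ∀ ⦃b' c' : ℝ⦄, 0 ≤ b' → 0 ≤ c' →
      2 ^ 15 * ((4 : ℝ) + 1) ^ 2 * ((4 : ℝ) + 4) ^ 2 * (L : ℝ) ^ 2 * b' ≤ 1 →
      23040 * (4 : ℝ) ^ 4 * (frameC 4 L + 4) ^ 3 * (c' + curConst 4 L * b' ^ 2) ≤ 1 →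
      b' + 226 * (8 * ((4 : ℝ) + 1) * ((4 : ℝ) + 4)) ^ 2 * b' ^ 2 < min (1 / (3 * C0 4)) (c2' 4 L / 2) →
      ∀ ⦃ε s₁ b : ℝ⦄, 0 < ε → ε ≤ r → 0 ≤ s₁ → s₁ ≤ r → 0 ≤ b → b ≤ ε / 2 →
      ∀ ⦃s g' hol ℓ s₂ : ℝ⦄, s ≤ s₁ → g' + 2 * (b' + 226 * (8 * ((4 : ℝ) + 1) * ((4 : ℝ) + 4)) ^ 2 * b' ^ 2) * s₁ ≤ s₁ →
      ℓ + 16 * (b' + 226 * (8 * ((4 : ℝ) + 1) * ((4 : ℝ) + 4)) ^ 2 * b' ^ 2) * s ≤ s₁ → hol + 8 * (b' + 226 * (8 * ((4 : ℝ) + 1) * ((4 : ℝ) + 4)) ^ 2 * b' ^ 2) * s ≤ s₂ →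
      ∀ {dom : _root_.Set (Site 4 → Fin 4 → (Matrix n n ℂ)ˣ)},
        (
        ∀ k : ℕ, 1 ≤ k → ∀ V ∈ dom, ∀ UA UB : Site 4 → Fin 4 → (Matrix n n ℂ)ˣ,
          IsMinimiser 4 (sfClass 4 L N ε) L N k V UA → IsMinimiser 4 (sfClass 4 L N ε) L N (k + 1) V UB → Regular 4 L N b g (k + 1) UB →
          ∃ u : Site 4 → (Matrix n n ℂ)ˣ, (∀ x, u x ∈ unitaryUnits (Matrix n n ℂ)) ∧ IsPeriodicSite u (((N * L ^ k : ℕ) : ℤ)) ∧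
            (∃ Λ : ℕ → Set (Site 4), Λ k = Set.univ ∧ Restr129 L k Λ (rescale L (bavg L UB)) u) ∧
            ∃ A : Site 4 → Fin 4 → Matrix n n ℂ,
              (∀ x μ, IsSelfAdjoint (A x μ)) ∧ (∀ (x : Site 4) (κ μ : Fin 4), A (x + (((N * L ^ k : ℕ) : ℤ)) • e κ) μ = A x μ) ∧
              mgauge (rescale L (bavg L UB)) u (cfgExp (((L : ℝ) ^ k)⁻¹) A)
                = pert (gaugeAct (ptw L (rescale L (bavg L UB)) UA k) UA) (rescale L (bavg L UB)) ∧
              (∀ x μ, ‖A x μ‖ ≤ s) ∧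
              (∀ (μ : Fin 4) (x : Site 4) (κ : Fin 4), ‖covDerivFwd (((L : ℝ) ^ k)⁻¹) (rescale L (bavg L UB)) μ (fun z => A z κ) x‖ ≤ g') ∧
              IsLandau138 L k (((L : ℝ) ^ k)⁻¹) Set.univ (torusLam k) (rescale L (bavg L UB)) A ∧
              (∀ (μ : Fin 4) (y : Site 4) (κ : Fin 4),
                ‖Ad (rescale L (bavg L UB) y μ) (covDerivFwd (((L : ℝ) ^ k)⁻¹) (rescale L (bavg L UB)) μ (fun z => A z κ) (y + e μ)) - covDerivFwd (((L : ℝ) ^ k)⁻¹) (rescale L (bavg L UB)) μ (fun z => A z κ) y‖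
                  ≤ hol * (((L : ℝ)⁻¹) ^ k) ^ (1 : ℝ)) ∧
              (∀ (x : Site 4) (κ : Fin 4), ‖covLap (((L : ℝ) ^ k)⁻¹) (rescale L (bavg L UB)) (fun z => A z κ) x‖ ≤ ℓ)) →
        LeafH3sup 4 L N ε b' c' dom →
        NE3EnergyRateWCov 4 (sfClass 4 L N ε) L N b g C s₁ s₂ dom := by
  obtain ⟨r, hr0, hr⟩ := n16_of_thm4OutputLandau138 (n := n) hL hN
  refine ⟨r, hr0, fun g hg => ?_⟩
  obtain ⟨C, hC0, hC⟩ := hr hg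
  refine ⟨C, hC0, fun b' c' hb' hc' hRb hcF hb'α ε s₁ b hε hεr hs₁ hs₁r hb hbh s g' hol ℓ s₂ hss hgrad hℓ hhol dom hOut h3 => ?_⟩
  have hbs' : 512 * (((4 : ℕ) : ℝ) + 1) * (((4 : ℕ) : ℝ) + 4) * (L : ℝ) ^ 2 * b' ≤ 1 := by
    have h0 : 0 ≤ (L : ℝ) ^ 2 * b' := by positivity
    push_cast; nlinarith only [h0, hRb]
  have hℓ' : ℓ + 4 * ((4 : ℕ) : ℝ) * (b' + 226 * (8 * (((4 : ℕ) : ℝ) + 1) * (((4 : ℕ) : ℝ) + 4)) ^ 2 * b' ^ 2) * s ≤ s₁ := by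
    push_cast; linarith only [hℓ]
  have hhol' : hol + 8 * (b' + 226 * (8 * (((4 : ℕ) : ℝ) + 1) * (((4 : ℕ) : ℝ) + 4)) ^ 2 * b' ^ 2) * s ≤ s₂ := by push_cast; linarith only [hhol]
  exact hC hb' hc' hRb hcF hb'α hε hεr hs₁ hs₁r hb hbh hgrad s₂
    (thm4OutputLandau138_of_thm4OutputPrint hL hb' hbs' le_rfl hss hhol' hℓ' hOut h3) h3

/-! ## §2 The DECL column over (OUT_print) -/

/-- **N16 · THE ROW's DECL FROM [B8] THM 4's OUTPUT AT THE PAIR IN PRINT's LETTERS AND N07's INTERFACE** (`d = 4`; `L ≥ 2`, `N ≥ 1`) — file 9 §4's numeric regime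
verbatim (N05's regularity letter `g := gradConst 4 c`), four k-free letter lines `s ≤ s₁`, `g′ + 2α_b s₁ ≤ s₁`, `ℓ + 16α_b s ≤ s₁`, `hol + 8α_b s ≤ s₂` (`α_b = b +
226·320²·b²`, `b` the sup letter), (OUT_print) at `(s, g′, hol, ℓ, β = 1)`, `dom ⊆ sfClass 4 L N ε₁ 0`, (H3ˢᵘᵖ) `LeafH3sup 4 L N ε b c dom`; conclusion verbatim (a regular
selection exists; for every such selection `∃ C′ ≥ 0, NE3Shape (minActReadings …) C′ (L⁻¹)`).  File 9 §4 ∘ file 11 §3.  N16 ∕ NE3 NOT proved. [folklore] -/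
theorem ne3Shape_of_thm4OutputPrint [Nonempty n] {L N : ℕ} (hL : 2 ≤ L) (hN : 1 ≤ N) :
    ∃ r : ℝ, 0 < r ∧ ∀ ⦃ε s₁ t b c ε₁ : ℝ⦄, 0 < ε → ε ≤ r → 0 ≤ s₁ → s₁ ≤ r →
      0 ≤ b → b ≤ t → 0 < c → c ≤ t →
      (2 : ℝ) ^ 91 * (L : ℝ) ^ 17 * t ≤ 1 → (2 : ℝ) ^ 76 * (L : ℝ) ^ 12 * t ≤ ε →
      16 * C0 4 * ε ≤ 3 → 1024 * (4 + 1) * (4 + 4) * (L : ℝ) ^ 2 * ε ≤ 1 → b ≤ ε / 2 →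
      23040 * (4 : ℝ) ^ 4 * (frameC 4 L + 4) ^ 3 * (c + curConst 4 L * b ^ 2) ≤ 1 →
      b + 226 * (8 * ((4 : ℝ) + 1) * ((4 : ℝ) + 4)) ^ 2 * b ^ 2 < min (1 / (3 * C0 4)) (c2' 4 L / 2) →
      ε₁ ≤ 1 / 4 → ε₁ ≤ b → 4 * ε₁ ≤ c →
      ∀ ⦃s g' hol ℓ s₂ : ℝ⦄, s ≤ s₁ → g' + 2 * (b + 226 * (8 * ((4 : ℝ) + 1) * ((4 : ℝ) + 4)) ^ 2 * b ^ 2) * s₁ ≤ s₁ →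
      ℓ + 16 * (b + 226 * (8 * ((4 : ℝ) + 1) * ((4 : ℝ) + 4)) ^ 2 * b ^ 2) * s ≤ s₁ → hol + 8 * (b + 226 * (8 * ((4 : ℝ) + 1) * ((4 : ℝ) + 4)) ^ 2 * b ^ 2) * s ≤ s₂ →
      ∀ {dom : Set (Site 4 → Fin 4 → (Matrix n n ℂ)ˣ)}, dom ⊆ sfClass 4 L N ε₁ 0 →
        (
        ∀ k : ℕ, 1 ≤ k → ∀ V ∈ dom, ∀ UA UB : Site 4 → Fin 4 → (Matrix n n ℂ)ˣ,
          IsMinimiser 4 (sfClass 4 L N ε) L N k V UA → IsMinimiser 4 (sfClass 4 L N ε) L N (k + 1) V UB → Regular 4 L N b (gradConst 4 c) (k + 1) UB →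
          ∃ u : Site 4 → (Matrix n n ℂ)ˣ, (∀ x, u x ∈ unitaryUnits (Matrix n n ℂ)) ∧ IsPeriodicSite u (((N * L ^ k : ℕ) : ℤ)) ∧
            (∃ Λ : ℕ → Set (Site 4), Λ k = Set.univ ∧ Restr129 L k Λ (rescale L (bavg L UB)) u) ∧
            ∃ A : Site 4 → Fin 4 → Matrix n n ℂ,
              (∀ x μ, IsSelfAdjoint (A x μ)) ∧ (∀ (x : Site 4) (κ μ : Fin 4), A (x + (((N * L ^ k : ℕ) : ℤ)) • e κ) μ = A x μ) ∧
              mgauge (rescale L (bavg L UB)) u (cfgExp (((L : ℝ) ^ k)⁻¹) A)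
                = pert (gaugeAct (ptw L (rescale L (bavg L UB)) UA k) UA) (rescale L (bavg L UB)) ∧
              (∀ x μ, ‖A x μ‖ ≤ s) ∧
              (∀ (μ : Fin 4) (x : Site 4) (κ : Fin 4), ‖covDerivFwd (((L : ℝ) ^ k)⁻¹) (rescale L (bavg L UB)) μ (fun z => A z κ) x‖ ≤ g') ∧
              IsLandau138 L k (((L : ℝ) ^ k)⁻¹) Set.univ (torusLam k) (rescale L (bavg L UB)) A ∧
              (∀ (μ : Fin 4) (y : Site 4) (κ : Fin 4),
                ‖Ad (rescale L (bavg L UB) y μ) (covDerivFwd (((L : ℝ) ^ k)⁻¹) (rescale L (bavg L UB)) μ (fun z => A z κ) (y + e μ)) - covDerivFwd (((L : ℝ) ^ k)⁻¹) (rescale L (bavg L UB)) μ (fun z => A z κ) y‖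
                  ≤ hol * (((L : ℝ)⁻¹) ^ k) ^ (1 : ℝ)) ∧
              (∀ (x : Site 4) (κ : Fin 4), ‖covLap (((L : ℝ) ^ k)⁻¹) (rescale L (bavg L UB)) (fun z => A z κ) x‖ ≤ ℓ)) →
        LeafH3sup 4 L N ε b c dom →
        (∃ sel : ℕ → (Site 4 → Fin 4 → (Matrix n n ℂ)ˣ) → (Site 4 → Fin 4 → (Matrix n n ℂ)ˣ),
            ∀ V ∈ dom, ∀ k : ℕ, IsMinimiser 4 (sfClass 4 L N ε) L N k V (sel k V) ∧ RegularSup 4 L N b c k (sel k V)) ∧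
        ∀ sel : ℕ → (Site 4 → Fin 4 → (Matrix n n ℂ)ˣ) → (Site 4 → Fin 4 → (Matrix n n ℂ)ˣ),
          (∀ V ∈ dom, ∀ k : ℕ, IsMinimiser 4 (sfClass 4 L N ε) L N k V (sel k V)) →
          (∀ V ∈ dom, ∀ k : ℕ, RegularSup 4 L N b c k (sel k V)) →
          ∃ C' : ℝ, 0 ≤ C' ∧
            NE3Shape
              (minActReadings 4 (sfClass 4 L N ε) L N dom
                (fun k V (x : ↥(periodBox (d := 4) N)) =>
                  fineAction (sel k V) (((blockSites L)^[k] {(x : Site 4)}) ×ˢ Finset.univ)))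
              C' ((L : ℝ)⁻¹) := by
  obtain ⟨r, hr0, hr⟩ := ne3Shape_of_thm4OutputLandau138 (n := n) hL hN
  refine ⟨r, hr0, fun ε s₁ t b c ε₁ hε hεr hs₁ hs₁r hb hbt hc hct hsmall hεt hε1 hε2 hbε hcF hbα' hε₁ hε₁b hε₁c s g' hol ℓ s₂ hss hgrad hℓ hhol dom hdom
    hOut h3 => ?_⟩
  have hL1 : 1 ≤ L := by omega
  have hL1r : (1 : ℝ) ≤ L := by exact_mod_cast hL1
  -- `512·5·8·L²·b ≤ 1` from the numeral (as in g2's knit)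
  have hbs : 512 * (((4 : ℕ) : ℝ) + 1) * (((4 : ℕ) : ℝ) + 4) * (L : ℝ) ^ 2 * b ≤ 1 := by
    have h2 : (L : ℝ) ^ 2 ≤ (L : ℝ) ^ 17 := pow_le_pow_right₀ hL1r (by norm_num)
    have h5 : (L : ℝ) ^ 2 * b ≤ (L : ℝ) ^ 17 * t := mul_le_mul h2 hbt hb (by positivity)
    have h7 : 0 ≤ (L : ℝ) ^ 17 * t := le_trans (by positivity) h5
    push_cast; nlinarith only [h5, h7, hsmall]
  have hℓ' : ℓ + 4 * ((4 : ℕ) : ℝ) * (b + 226 * (8 * (((4 : ℕ) : ℝ) + 1) * (((4 : ℕ) : ℝ) + 4)) ^ 2 * b ^ 2) * s ≤ s₁ := by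
    push_cast; linarith only [hℓ]
  have hhol' : hol + 8 * (b + 226 * (8 * (((4 : ℕ) : ℝ) + 1) * (((4 : ℕ) : ℝ) + 4)) ^ 2 * b ^ 2) * s ≤ s₂ := by push_cast; linarith only [hhol]
  exact hr hε hεr hs₁ hs₁r hb hbt hc hct hsmall hεt hε1 hε2 hbε hcF hbα' hε₁ hε₁b hε₁c hgrad s₂ hdom
    (thm4OutputLandau138_of_thm4OutputPrint hL hb hbs le_rfl hss hhol' hℓ' hOut h3) h3

end

end Summit.QuantumFields.YangMills.BalabanUVNodes.N16
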